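import Summits.AtomisticToContinuum.FouriersLaw.Theses.HoelderEscapeProfile

/-!
# Birth skeleton (`Lines/birth.lean`, BC3) for crux `HoelderEscapeProfile.AbelSpreadCeiling`
(item `stmt-AtomisticToContinuum-16010`, route `route-AtomisticToContinuum-HoelderEscapeProfile`, crux rank 4;
sub-problem `FouriersLaw`; registrar `planner-skel-stmt-AtomisticToContinuum-16010-0`, 2026-08-17)

Crux (FIXED, concluded BY NAME below). Arena of the route: the infinite pinned chain
`pinnedChain ω₂ lam β γ` (`ω₂, lam, β > 0`, any `γ`) at `T > 0`, a shift- and momentum-reversal-invariant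
Gibbs state `μ`, a `μ`-preserving, a.e. shift-covariant `InfiniteChainDynamics D`, the split-bond site energy
`h_x`, the PULSE `S(x,t) = Cov(h_0, h_x ∘ φ_t)` and its ABEL ESCAPE PROFILE `S̄_ν(x) = ν∫₀^∞ e^{-νt} S(x,t) dt`.
`AbelSpreadCeiling`: if `e^{-νt}S(x,t)` is integrable on `(0,∞)` for all `x`, `ν > 0` and
`Σ_x (1+x²)|S̄_ν(x)| < ∞`, then `∃ B, ν₀ > 0` with `Σ_x x² S̄_ν(x) ≤ B/ν` for `0 < ν ≤ ν₀` — the Abel-averaged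
pulse spreads at most diffusively (= finiteness of the Abelian Green–Kubo conductivity, by Helfand–Abel).

## Line `birth` — TIME-DOMAIN CEILING + ABELIAN TRANSFER (three registered stubs)

The route's own two-layer plan ("AbelSpreadCeiling ⇐ CoercivePulse.LinearCeiling + PulseCalculus → one Abelian
lemma", confirmed by the route-review refuter's note on the item) made precise and kernel-checked:

* `stub_pulseMomentRegular` (INFRASTRUCTURE, size M; = clauses (3)–(4) of `CoercivePulse.PulseCalculus`,
  stmt-AtomisticToContinuum-15385, so it closes by projection once that shared item lands): at every fixed
  time the pulse has a finite `x²`-weighted absolute moment `Σ_x (1+x²)|S(x,t)| < ∞` (fixed-time light cone +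
  Gibbs clustering) and the HELFAND MOMENT `M(t) = Σ_x x² S(x,t)` is continuous in `t`.
* `stub_timeCeiling` (THE DYNAMICAL CONTENT, size XL, open; VERBATIM the signature of
  `CoercivePulse.LinearCeiling`, stmt-AtomisticToContinuum-15383 — one proof closes both): the Helfand moment has an
  eventually LINEAR upper envelope, `∃ b t₃, ∀ t ≥ t₃, M(t) ≤ M(t₃) + b(t - t₃)` — no super-diffusive episodes.
  Strictly on the time side: no Laplace transform, no `ν`.
* `stub_abelMomentExchange` (THE ABELIAN TRANSFER, size M–L; the genuinely route-specific piece): under the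
  crux's own hypotheses plus the fixed-time moments of stub 1, for every `ν > 0` the function `e^{-νt}M(t)` is
  integrable on `(0,∞)` and the second moment of the Abel profile IS the Abel mean of the Helfand moment,
  `Σ_x x² S̄_ν(x) = ν∫₀^∞ e^{-νt} M(t) dt` (Fubini/Tonelli across `Σ_x` and `∫dt`, i.e. an ABEL-WEIGHTED light-cone
  bound `Σ_x x² ∫₀^∞ e^{-νt}|S(x,t)| dt < ∞` — exactly the estimate the route's FibreCalculus flags as unprinted).
* COMPOSITION `AbelSpreadCeiling_of` (sorry-free, this file): the pure real-analysis ABELIAN LEMMA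
  `abelMean_le_of_linearEnvelope` — a continuous `M` with `M(t) ≤ M(t₃) + b(t-t₃)` for `t ≥ t₃` satisfies
  `M(t) ≤ A₀ + |b|t` on `[0,∞)` (compactness on `[0, max t₃ 0]`), hence, using `t ≤ (2/ν)e^{νt/2}`,
  `ν∫₀^∞ e^{-νt}M ≤ ν(A₀/ν + 4|b|/ν²) ≤ (A₀ + 4|b|)/ν` for `0 < ν ≤ 1` — fed with the three stubs at the
  route's arena gives the crux BY NAME with `ν₀ = 1`, `B = A₀ + 4|b|`.

Hardest stub: `stub_timeCeiling` (all the dynamics: it is false at the harmonic member `lam·β = 0`, where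
`M(t) ≈ 0.19 t²`, exactly the ballistic delimiter recorded on the item; the other two stubs hold there).
Why the cut is not a costume: stub 2 never mentions `ν` or an Abel mean, stub 3 is an IDENTITY (no inequality,
no growth claim), stub 1 is fixed-time regularity; none implies the crux or `FouriersLaw` by
`first | exact? | simpa | aesop` (BC3 probes, folder `bc/`), and the crux implies none of them (an Abel `O(1/ν)`
bound gives no pointwise-in-time envelope without a Tauberian hypothesis).

## Disproof used
None on file: `ledger crux ls stmt-AtomisticToContinuum-16010` shows no workfiles (no `Disproof.lean`, no
`Negative/` lemma) before this one, and no `Cruxes/LinearCeiling/` directory exists for the verbatim twin.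
Negatives index (`ledger negatives --problem AtomisticToContinuum`, 20 entries, 2 on FouriersLaw: OddCorrectorDecay
stmt-9139, FarFieldGaussianity stmt-12890): nothing on the pulse second moment or its Abel mean — no stub is an
instance of a refuted statement. Barrier honoured: `HarmonicChainBallisticFlux` — stub 2 (hence the line) is
false at `lam = 0`, consistent with `not_fouriersLawFor_harmonic`; the hypotheses `0 < lam`, `0 < β` are load-bearing
there and only there.
-/

noncomputable section

open MeasureTheory Filter Set
open scoped Topology BigOperators

namespace Summit.AtomisticToContinuum.FouriersLaw.Cruxes.AbelSpreadCeiling.Birth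

open Literature.MathematicalPhysics.KineticTheory.HeatConduction

/-! ### The registered stubs (`sorry` lives ONLY here)

All three are stated over the route's arena VERBATIM (same binders, same defining equations for `h`, `S`,
`Sb` as the crux `HoelderEscapeProfile.AbelSpreadCeiling`), so that `AbelSpreadCeiling_of` instantiates them
by mere application. -/

/-- STUB 1 `stub_pulseMomentRegular` (infrastructure, size M) — FIXED-TIME MOMENTS OF THE PULSE: for the
guarded `(μ, D)` of the arena, `Σ_x (1+x²)|S(x,t)| < ∞` at every `t` and the Helfand moment
`t ↦ M(t) = Σ_x x² S(x,t)` is continuous. Clauses (3)–(4) of the shared item `CoercivePulse.PulseCalculus`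
(stmt-AtomisticToContinuum-15385). [cite: LanfordLebowitzLieb1977, Thm 3] [cite: Helfand1960, §II] -/
theorem stub_pulseMomentRegular :
    ∀ ω₂ lam β γ : ℝ, 0 < ω₂ → 0 < lam → 0 < β → ∀ T : ℝ, 0 < T →
      ∀ μ : MeasureTheory.Measure ChainConfig, (pinnedChain ω₂ lam β γ).IsChainGibbsMeasure T μ →
      IsShiftInvariant μ → μ.map (fun σ : ChainConfig => fun x : ℤ => ((σ x).1, -(σ x).2)) = μ →
      ∀ D : InfiniteChainDynamics (pinnedChain ω₂ lam β γ), D.PreservesMeasure μ →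
      (∀ t : ℝ, ∀ᵐ σ ∂μ, D.flow t (shift σ) = shift (D.flow t σ)) →
      ∀ h : ChainConfig → ℤ → ℝ, h = (fun (σ : ChainConfig) (x : ℤ) => (σ x).2 ^ 2 / 2 +
          (pinnedChain ω₂ lam β γ).U (σ x).1 + ((pinnedChain ω₂ lam β γ).V ((σ (x + 1)).1 - (σ x).1) +
          (pinnedChain ω₂ lam β γ).V ((σ x).1 - (σ (x - 1)).1)) / 2) →
      ∀ S : ℤ → ℝ → ℝ, S = (fun (x : ℤ) (t : ℝ) =>
          ∫ σ, (h σ 0 - ∫ σ', h σ' 0 ∂μ) * (h (D.flow t σ) x - ∫ σ', h σ' 0 ∂μ) ∂μ) →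
      (∀ t : ℝ, Summable (fun x : ℤ => (1 + (x : ℝ) ^ 2) * |S x t|)) ∧
        Continuous (fun t : ℝ => ∑' x : ℤ, (x : ℝ) ^ 2 * S x t) := by
  sorry

/-- STUB 2 `stub_timeCeiling` (the dynamical content, size XL; VERBATIM `CoercivePulse.LinearCeiling`,
stmt-AtomisticToContinuum-15383) — DIFFUSIVE UPPER ENVELOPE OF THE HELFAND MOMENT IN TIME: for the guarded
`(μ, D)`, if `Σ_x (1+x²)|S(x,t)| < ∞` at every `t`, there are `b, t₃` with `M(t) ≤ M(t₃) + b(t - t₃)` for all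
`t ≥ t₃` — the averaged pulse spreads at most diffusively; false at the harmonic member (`M ≈ 0.19t²`).
[cite: Helfand1960, §II] [cite: RiederLebowitzLieb1967, §3] [cite: Dhar2008, §3] -/
theorem stub_timeCeiling :
    ∀ ω₂ lam β γ : ℝ, 0 < ω₂ → 0 < lam → 0 < β → ∀ T : ℝ, 0 < T →
      ∀ μ : MeasureTheory.Measure ChainConfig, (pinnedChain ω₂ lam β γ).IsChainGibbsMeasure T μ →
      IsShiftInvariant μ → μ.map (fun σ : ChainConfig => fun x : ℤ => ((σ x).1, -(σ x).2)) = μ →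
      ∀ D : InfiniteChainDynamics (pinnedChain ω₂ lam β γ), D.PreservesMeasure μ →
      (∀ t : ℝ, ∀ᵐ σ ∂μ, D.flow t (shift σ) = shift (D.flow t σ)) →
      ∀ h : ChainConfig → ℤ → ℝ, h = (fun (σ : ChainConfig) (x : ℤ) => (σ x).2 ^ 2 / 2 +
          (pinnedChain ω₂ lam β γ).U (σ x).1 + ((pinnedChain ω₂ lam β γ).V ((σ (x + 1)).1 - (σ x).1) +
          (pinnedChain ω₂ lam β γ).V ((σ x).1 - (σ (x - 1)).1)) / 2) →
      ∀ S : ℤ → ℝ → ℝ, S = (fun (x : ℤ) (t : ℝ) =>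
          ∫ σ, (h σ 0 - ∫ σ', h σ' 0 ∂μ) * (h (D.flow t σ) x - ∫ σ', h σ' 0 ∂μ) ∂μ) →
      (∀ t : ℝ, Summable (fun x : ℤ => (1 + (x : ℝ) ^ 2) * |S x t|)) →
        ∃ b t₃ : ℝ, ∀ t : ℝ, t₃ ≤ t →
          ∑' x : ℤ, (x : ℝ) ^ 2 * S x t ≤ (∑' x : ℤ, (x : ℝ) ^ 2 * S x t₃) + b * (t - t₃) := by
  sorry

/-- STUB 3 `stub_abelMomentExchange` (the Abelian transfer, size M–L) — THE SECOND MOMENT OF THE ABEL PROFILE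
IS THE ABEL MEAN OF THE HELFAND MOMENT: for the guarded `(μ, D)`, under the crux's hypotheses
(`e^{-νt}S(x,t)` integrable on `(0,∞)` for all `x`, `ν > 0`; `Σ_x (1+x²)|S̄_ν(x)| < ∞`) and the fixed-time
moments of stub 1, for every `ν > 0`: `e^{-νt}M(t)` is integrable on `(0,∞)` and
`Σ_x x² S̄_ν(x) = ν ∫₀^∞ e^{-νt} M(t) dt` — Fubini/Tonelli across `Σ_x`/`∫dt`, i.e. the Abel-weighted light-cone
bound `Σ_x x² ∫₀^∞ e^{-νt}|S(x,t)|dt < ∞`. [cite: Helfand1960, §II] [cite: BonettoLebowitzReyBellet2000, §6.3]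
[cite: ButtaEtAl2007, Thm 2.1] -/
theorem stub_abelMomentExchange :
    ∀ ω₂ lam β γ : ℝ, 0 < ω₂ → 0 < lam → 0 < β → ∀ T : ℝ, 0 < T →
      ∀ μ : MeasureTheory.Measure ChainConfig, (pinnedChain ω₂ lam β γ).IsChainGibbsMeasure T μ →
      IsShiftInvariant μ → μ.map (fun σ : ChainConfig => fun x : ℤ => ((σ x).1, -(σ x).2)) = μ →
      ∀ D : InfiniteChainDynamics (pinnedChain ω₂ lam β γ), D.PreservesMeasure μ →
      (∀ t : ℝ, ∀ᵐ σ ∂μ, D.flow t (shift σ) = shift (D.flow t σ)) →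
      ∀ h : ChainConfig → ℤ → ℝ, h = (fun (σ : ChainConfig) (x : ℤ) => (σ x).2 ^ 2 / 2 +
          (pinnedChain ω₂ lam β γ).U (σ x).1 + ((pinnedChain ω₂ lam β γ).V ((σ (x + 1)).1 - (σ x).1) +
          (pinnedChain ω₂ lam β γ).V ((σ x).1 - (σ (x - 1)).1)) / 2) →
      ∀ S : ℤ → ℝ → ℝ, S = (fun (x : ℤ) (t : ℝ) =>
          ∫ σ, (h σ 0 - ∫ σ', h σ' 0 ∂μ) * (h (D.flow t σ) x - ∫ σ', h σ' 0 ∂μ) ∂μ) →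
      ∀ Sb : ℝ → ℤ → ℝ, Sb = (fun (ν : ℝ) (x : ℤ) =>
          ν * ∫ t in Set.Ioi (0:ℝ), Real.exp (-(ν * t)) * S x t) →
      (∀ x : ℤ, ∀ ν : ℝ, 0 < ν →
          MeasureTheory.IntegrableOn (fun t : ℝ => Real.exp (-(ν * t)) * S x t) (Set.Ioi 0)) →
      (∀ ν : ℝ, 0 < ν → Summable (fun x : ℤ => (1 + (x : ℝ) ^ 2) * |Sb ν x|)) →
      (∀ t : ℝ, Summable (fun x : ℤ => (1 + (x : ℝ) ^ 2) * |S x t|)) →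
        ∀ ν : ℝ, 0 < ν →
          MeasureTheory.IntegrableOn
              (fun t : ℝ => Real.exp (-(ν * t)) * ∑' x : ℤ, (x : ℝ) ^ 2 * S x t) (Set.Ioi 0) ∧
            ∑' x : ℤ, (x : ℝ) ^ 2 * Sb ν x =
              ν * ∫ t in Set.Ioi (0:ℝ), Real.exp (-(ν * t)) * ∑' x : ℤ, (x : ℝ) ^ 2 * S x t := by
  sorry

/-! ### By-name statements of the registered stubs

The skeleton audit (`#h21_check_skeleton`) wants the hypotheses of the crux-concluding theorem to be the
declared stubs BY NAME; `Registered.stub_x` is DEFINITIONALLY the statement of the sorried `theorem stub_x`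
(`type_of%`), so `AbelSpreadCeiling_of : Registered.stub_pulseMomentRegular → Registered.stub_timeCeiling →
Registered.stub_abelMomentExchange → AbelSpreadCeiling` is literally "stub signatures → crux", and the `example`
at the end type-checks `AbelSpreadCeiling_of stub_pulseMomentRegular stub_timeCeiling stub_abelMomentExchange`. -/

namespace Registered

/-- Statement of registered stub 1 (`stub_pulseMomentRegular`), by name. -/
def stub_pulseMomentRegular : Prop := type_of% Birth.stub_pulseMomentRegular

/-- Statement of registered stub 2 (`stub_timeCeiling`), by name. -/
def stub_timeCeiling : Prop := type_of% Birth.stub_timeCeiling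

/-- Statement of registered stub 3 (`stub_abelMomentExchange`), by name. -/
def stub_abelMomentExchange : Prop := type_of% Birth.stub_abelMomentExchange

end Registered

/-! ### The Abelian lemma (pure real analysis, no `sorry`) -/

/-- `∫_{(0,∞)} e^{-ct} dt = 1/c` for `c > 0`. [folklore] -/
theorem integral_exp_neg_mul_Ioi {c : ℝ} (hc : 0 < c) :
    ∫ t in Ioi (0:ℝ), Real.exp (-(c * t)) = 1 / c := by
  have h : ∫ t in Ioi (0:ℝ), Real.exp (-c * t) = -Real.exp (-c * 0) / -c :=
    integral_exp_mul_Ioi (neg_lt_zero.mpr hc) 0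
  rw [mul_zero, Real.exp_zero, neg_div_neg_eq] at h
  simpa only [neg_mul] using h

/-- `t ↦ e^{-ct}` is integrable on `(a,∞)` for `c > 0`. [folklore] -/
theorem exp_neg_mul_integrableOn_Ioi {c : ℝ} (hc : 0 < c) (a : ℝ) :
    IntegrableOn (fun t : ℝ => Real.exp (-(c * t))) (Ioi a) := by
  simpa only [neg_mul] using exp_neg_integrableOn_Ioi a hc

/-- **The Abelian lemma of the line.** A continuous `M : ℝ → ℝ` with an eventually linear upper
envelope `M(t) ≤ M(t₃) + b(t - t₃)` (`t ≥ t₃`), whose Laplace integrands `e^{-νt}M(t)` are integrable on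
`(0,∞)`, has Abel means `ν∫₀^∞ e^{-νt}M(t) dt ≤ B/ν` for all `0 < ν ≤ 1` (`B = A₀ + 4|b|`, `A₀` a bound for
`M` on `[0, max t₃ 0]` plus `|M t₃| + |b||t₃|`). [folklore] -/
theorem abelMean_le_of_linearEnvelope (M : ℝ → ℝ) (hM : Continuous M) {b t₃ : ℝ}
    (henv : ∀ t, t₃ ≤ t → M t ≤ M t₃ + b * (t - t₃))
    (hint : ∀ ν, 0 < ν → IntegrableOn (fun t => Real.exp (-(ν * t)) * M t) (Ioi 0)) :
    ∃ B : ℝ, ∀ ν, 0 < ν → ν ≤ 1 → ν * ∫ t in Ioi (0:ℝ), Real.exp (-(ν * t)) * M t ≤ B / ν := by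
  -- a bound for `M` on the compact initial segment `[0, max t₃ 0]`
  obtain ⟨K, hK⟩ := (isCompact_Icc (a := (0:ℝ)) (b := max t₃ 0)).exists_bound_of_continuousOn
    hM.continuousOn
  have hK0 : 0 ≤ K := (norm_nonneg (M 0)).trans (hK 0 ⟨le_rfl, le_max_right _ _⟩)
  obtain ⟨A₀, hA₀def⟩ : ∃ A₀ : ℝ, A₀ = K + |M t₃| + |b| * |t₃| := ⟨_, rfl⟩
  have hA₀ : 0 ≤ A₀ := by
    have h1 : 0 ≤ |M t₃| := abs_nonneg _
    have h2 : 0 ≤ |b| * |t₃| := mul_nonneg (abs_nonneg b) (abs_nonneg t₃)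
    linarith
  -- the global affine envelope on `[0, ∞)`
  have henv' : ∀ t, 0 ≤ t → M t ≤ A₀ + |b| * t := by
    intro t ht
    have hbt : 0 ≤ |b| * t := mul_nonneg (abs_nonneg b) ht
    rcases le_or_gt t (max t₃ 0) with hle | hlt
    · have h1 : ‖M t‖ ≤ K := hK t ⟨ht, hle⟩
      rw [Real.norm_eq_abs] at h1
      have h2 : M t ≤ K := (le_abs_self _).trans h1
      have h3 : 0 ≤ |M t₃| := abs_nonneg _
      have h4 : 0 ≤ |b| * |t₃| := mul_nonneg (abs_nonneg b) (abs_nonneg t₃)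
      linarith
    · have h3 : t₃ ≤ t := le_trans (le_max_left _ _) hlt.le
      have h4 := henv t h3
      have e1 : b * t ≤ |b| * t := mul_le_mul_of_nonneg_right (le_abs_self b) ht
      have e2 : -(b * t₃) ≤ |b| * |t₃| := by rw [← abs_mul]; exact neg_le_abs _
      have e3 : M t₃ ≤ |M t₃| := le_abs_self _
      linarith
  refine ⟨A₀ + 4 * |b|, fun ν hν hν1 => ?_⟩
  have hν0 : ν ≠ 0 := hν.ne'
  have hν2 : 0 < ν / 2 := half_pos hν
  -- pointwise majorant `e^{-νt}M(t) ≤ A₀e^{-νt} + (2|b|/ν)e^{-νt/2}` on `(0,∞)` (uses `t ≤ (2/ν)e^{νt/2}`)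
  have hpt : ∀ t ∈ Ioi (0:ℝ), Real.exp (-(ν * t)) * M t ≤
      A₀ * Real.exp (-(ν * t)) + 2 * |b| / ν * Real.exp (-(ν / 2 * t)) := by
    intro t ht
    have ht' : 0 ≤ t := le_of_lt (mem_Ioi.1 ht)
    have h0 : ν / 2 * t ≤ Real.exp (ν / 2 * t) := by linarith [Real.add_one_le_exp (ν / 2 * t)]
    have h1 : t ≤ 2 / ν * Real.exp (ν / 2 * t) :=
      calc t = 2 / ν * (ν / 2 * t) := by field_simp
        _ ≤ 2 / ν * Real.exp (ν / 2 * t) := mul_le_mul_of_nonneg_left h0 (by positivity)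
    have h2 : Real.exp (-(ν * t)) * Real.exp (ν / 2 * t) = Real.exp (-(ν / 2 * t)) := by
      rw [← Real.exp_add]; congr 1; ring
    have h3 : Real.exp (-(ν * t)) * t ≤ Real.exp (-(ν * t)) * (2 / ν * Real.exp (ν / 2 * t)) :=
      mul_le_mul_of_nonneg_left h1 (Real.exp_pos _).le
    have h4 : Real.exp (-(ν * t)) * M t ≤ Real.exp (-(ν * t)) * (A₀ + |b| * t) :=
      mul_le_mul_of_nonneg_left (henv' t ht') (Real.exp_pos _).le
    calc Real.exp (-(ν * t)) * M t ≤ Real.exp (-(ν * t)) * (A₀ + |b| * t) := h4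
      _ = A₀ * Real.exp (-(ν * t)) + |b| * (Real.exp (-(ν * t)) * t) := by ring
      _ ≤ A₀ * Real.exp (-(ν * t)) + |b| * (Real.exp (-(ν * t)) * (2 / ν * Real.exp (ν / 2 * t))) :=
          add_le_add_right (mul_le_mul_of_nonneg_left h3 (abs_nonneg b)) _
      _ = A₀ * Real.exp (-(ν * t)) + 2 * |b| / ν * (Real.exp (-(ν * t)) * Real.exp (ν / 2 * t)) := by
          ring
      _ = A₀ * Real.exp (-(ν * t)) + 2 * |b| / ν * Real.exp (-(ν / 2 * t)) := by rw [h2]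
  -- integrability of the two pieces of the majorant
  have hf : IntegrableOn (fun t : ℝ => A₀ * Real.exp (-(ν * t))) (Ioi 0) :=
    (exp_neg_mul_integrableOn_Ioi hν 0).const_mul A₀
  have hg : IntegrableOn (fun t : ℝ => 2 * |b| / ν * Real.exp (-(ν / 2 * t))) (Ioi 0) :=
    (exp_neg_mul_integrableOn_Ioi hν2 0).const_mul (2 * |b| / ν)
  have hfg : IntegrableOn
      (fun t : ℝ => A₀ * Real.exp (-(ν * t)) + 2 * |b| / ν * Real.exp (-(ν / 2 * t))) (Ioi 0) :=
    hf.add hg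
  -- compare the integrals and evaluate the majorant's
  have hmono : ∫ t in Ioi (0:ℝ), Real.exp (-(ν * t)) * M t ≤
      ∫ t in Ioi (0:ℝ), (A₀ * Real.exp (-(ν * t)) + 2 * |b| / ν * Real.exp (-(ν / 2 * t))) :=
    setIntegral_mono_on (hint ν hν) hfg measurableSet_Ioi hpt
  have hval : ∫ t in Ioi (0:ℝ), (A₀ * Real.exp (-(ν * t)) + 2 * |b| / ν * Real.exp (-(ν / 2 * t))) =
      A₀ / ν + 4 * |b| / ν ^ 2 := by
    rw [integral_add hf hg, integral_const_mul, integral_const_mul, integral_exp_neg_mul_Ioi hν,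
      integral_exp_neg_mul_Ioi hν2]
    field_simp
    ring
  have hA₀ν : A₀ ≤ A₀ / ν := by
    rw [le_div_iff₀ hν]
    exact mul_le_of_le_one_right hA₀ hν1
  calc ν * ∫ t in Ioi (0:ℝ), Real.exp (-(ν * t)) * M t ≤ ν * (A₀ / ν + 4 * |b| / ν ^ 2) :=
        mul_le_mul_of_nonneg_left (hmono.trans hval.le) hν.le
    _ = A₀ + 4 * |b| / ν := by field_simp
    _ ≤ A₀ / ν + 4 * |b| / ν := add_le_add_left hA₀ν _
    _ = (A₀ + 4 * |b|) / ν := by rw [add_div]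

/-! ### The composition (kernel-checked, no `sorry`): the three stubs give the crux BY NAME -/

/-- `stub_pulseMomentRegular → stub_timeCeiling → stub_abelMomentExchange → AbelSpreadCeiling`: at the crux's
arena, stub 1 supplies the fixed-time moments and the continuity of the Helfand moment `M`, stub 2 its linear
envelope, stub 3 the integrability of `e^{-νt}M` and the exchange identity `Σ_x x²S̄_ν(x) = ν∫e^{-νt}M`; the
Abelian lemma `abelMean_le_of_linearEnvelope` then gives `Σ_x x²S̄_ν(x) ≤ B/ν` for `0 < ν ≤ ν₀ := 1`. [folklore] -/
theorem AbelSpreadCeiling_of (h1 : Registered.stub_pulseMomentRegular) (h2 : Registered.stub_timeCeiling)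
    (h3 : Registered.stub_abelMomentExchange) :
    _root_.Summit.AtomisticToContinuum.FouriersLaw.Theses.HoelderEscapeProfile.AbelSpreadCeiling := by
  intro ω₂ lam β γ hω hl hβ T hT μ hG hSI hR D hP hSh h hh S hS Sb hSb hInt hSum
  obtain ⟨hsum, hcont⟩ := h1 ω₂ lam β γ hω hl hβ T hT μ hG hSI hR D hP hSh h hh S hS
  obtain ⟨b, t₃, henv⟩ := h2 ω₂ lam β γ hω hl hβ T hT μ hG hSI hR D hP hSh h hh S hS hsum
  have hex := h3 ω₂ lam β γ hω hl hβ T hT μ hG hSI hR D hP hSh h hh S hS Sb hSb hInt hSum hsum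
  obtain ⟨B, hB⟩ := abelMean_le_of_linearEnvelope (fun t : ℝ => ∑' x : ℤ, (x : ℝ) ^ 2 * S x t) hcont
    henv (fun ν hν => (hex ν hν).1)
  refine ⟨B, 1, one_pos, fun ν hν hν1 => ?_⟩
  rw [(hex ν hν).2]
  exact hB ν hν hν1

/-- Type-check (not a declaration): the sorried stubs are literally the antecedents of `AbelSpreadCeiling_of`
(conditional on the stubs; an `example`, so it adds nothing to the environment). -/
example : _root_.Summit.AtomisticToContinuum.FouriersLaw.Theses.HoelderEscapeProfile.AbelSpreadCeiling :=
  AbelSpreadCeiling_of stub_pulseMomentRegular stub_timeCeiling stub_abelMomentExchange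

end Summit.AtomisticToContinuum.FouriersLaw.Cruxes.AbelSpreadCeiling.Birth

end
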